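import Summits.BirchSwinnertonDyer.BirchSwinnertonDyer.Theorems.SmallImageMuTransferMuTransferX9LocalSplitPrime
import Literature.NumberTheory.EllipticCurves.IwasawaTwistModPDual
import HarnessLib

/-!
# K6 crux `MuTransferX9` (stmt-BirchSwinnertonDyer-19276), CORE-PLAN S4.3 design (KOLY-MEMO §5.11.B (N1)):
# at an `E`-split prime the local Galois group acts TRIVIALLY on the multiplicity space `M = E[p]`, so
# every endomorphism of `M` commutes with the local twist `𝒯_J|_{Γ_{K_q}}` — the inputs `α`, `β`, `hc` of
# the tree's `cupProduct_adjoint` (adjoint naturality of the cup product)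

Cell `bsd-smallim`, seat `bsd-smallim-koly` gen 7 (route `SmallImageMuTransfer`, rung K6, leaf
`Rank1Residual.BSDpOnClassX9`). HONEST FRAMING: TOOL theorems; no definition, no named fact, no `sorry`;
nothing is asserted about any curve and nothing is booked. Serves the OPEN registered stub
`stub_coreX9` of crux 19276 (skeleton v4 0154dd5daf38efd6) — the non-generic inputs of the DESIGN of
record for CORE-PLAN S4.3 (MU-TRANSFER-PROOF Lemma 1 (iii) without a tame-symbol fact, KOLY-MEMO v1.8.7
§5.11.B): the generic input (N1) is the tree's `cupProduct_adjoint` (`ContinuousCupProductCompat.lean`,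
NSW I §4 (1.4.2)), the algebra (N2)/(N4) is `…X9PairingUniqueness.lean` — and credits nothing toward its
closure (`--supports … --as helper`). PARTITION (D-0054): X9 (A4) × p ∈ {5, 7} — helper; closes NONE.

## Content

* `toLocal_apply_eq_self_of_split` — at a finite place `q` with `ρ` unramified and an `E`-SPLIT local
  Frobenius (`ρ(res φ) = 1`, `IsFrobPow φ 1`), the WHOLE local Galois group `Γ_{K_q}` acts trivially on `M`
  (x9 `forall_apply_eq_iff_of_isFrobPow`): locally `𝒯_J|_q = M^{triv} ⊗ N_J`.
* `toLocal_twistModP_comp_endo` — hence for EVERY additive endomorphism `φ` of `M` and every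
  `g ∈ Γ_{K_q}`: `g·(φ ∘ x) = φ ∘ (g·x)` on `𝒯_J|_q` (`φ ⊗ 1` is `Γ_{K_q}`-equivariant; the unipotent twist
  commutes with coordinatewise maps, k6-ty `unipotentPow_mul_compLeft`) — the morphisms `α = φ ⊗ 1` on
  `𝒯_J|_q` and, for the dual model `𝒯_J(ρ′, κ⁻¹)|_q`, `β = φ′ ⊗ 1`.
* `convCoeff_comp_adjoint` / `gorensteinPairing_comp_adjoint` — for an `e`-ADJOINT pair
  (`e(φ m, m′) = e(m, φ′ m′)`): `C_k(φ ∘ x, y) = C_k(x, φ′ ∘ y)` for every convolution coefficient and for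
  the Gorenstein pairing — the compatibility hypothesis `hc` of `cupProduct_adjoint` for k6-ty's
  `twistContPairing`.
With these, `cupProduct_adjoint` gives `H¹(φ⊗1) a ∪ b = a ∪ H¹(φ′⊗1) b` for the local classes at an
`E`-split `q` — naturality (N1) of KOLY-MEMO §5.11.B, the input under which `…X9PairingUniqueness`
identifies the `tr × ur` local pairing with a unit multiple of the Gorenstein pairing.

References: HOME/koly/KOLY-MEMO.md §5.11.B; J. Neukirch, A. Schmidt, K. Wingberg, *Cohomology of Number
Fields* (2008) I §4 (1.4.2) [NeukirchSchmidtWingberg2008]; B. Mazur, K. Rubin, Mem. AMS 799 (2004) §1.3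
[MazurRubin2004].
-/

set_option linter.dupNamespace false
set_option autoImplicit false

noncomputable section

open scoped Classical

universe u

namespace Summit.BirchSwinnertonDyer.BirchSwinnertonDyer.Rank1Residual.LocalSplitPrime

open Function Field ValuativeRel NumberField IsDedekindDomain Finset
open Literature.NumberTheory.GaloisRepresentations
open Literature.NumberTheory.GaloisRepresentations.IsNonarchimedeanLocalField
open Literature.NumberTheory.EllipticCurves
open Summit.BirchSwinnertonDyer.Rank1Residual.GaloisImage

/-! ## §1 At an `E`-split prime the local Galois group acts trivially on `M` -/

section Split

variable {K : Type u} [Field K] [NumberField K] {M : Type u} [AddCommGroup M] [TopologicalSpace M]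
  [DiscreteTopology M] (ρ : DiscreteGaloisModule K M) {p : ℕ} [Fact p.Prime]
  (hM : ∀ x : M, p • x = 0) (κ : ZpExtension K p) (J : ℕ) (q : HeightOneSpectrum (𝓞 K))

omit [Fact p.Prime] in
/-- **At an `E`-split prime the local Galois group acts trivially on `M`**: `ρ` unramified at `q` and one
local Frobenius `φ` acting trivially (`ρ(res φ) = 1`) force `ρ(res g) = id` for every `g ∈ Γ_{K_q}` (the
Frobenius topologically generates `Γ_{K_q}/I`; x9's `forall_apply_eq_iff_of_isFrobPow`).
[cite: SerreLocalFields1979, XIII §1 Prop. 1] -/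
theorem toLocal_apply_eq_self_of_split (hunr : GaloisRep.IsUnramifiedAt q ρ)
    {φ : absoluteGaloisGroup (q.adicCompletion K)} (hφ : IsFrobPow φ 1)
    (hsplit : ρ (absGaloisRestrict K (q.adicCompletion K) φ) = 1)
    (g : absoluteGaloisGroup (q.adicCompletion K)) (m : M) : GaloisRep.toLocal q ρ g m = m := by
  have hI : ∀ t ∈ absInertia (q.adicCompletion K), ∀ w : M, GaloisRep.toLocal q ρ t w = w :=
    fun t ht w => by rw [(GaloisRep.isUnramifiedAt_iff_toLocal_holds q ρ).1 hunr t ht, Module.End.one_apply]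
  have hφm : GaloisRep.toLocal q ρ φ m = m := by
    rw [GaloisRep.toLocal_apply, hsplit, Module.End.one_apply]
  exact (forall_apply_eq_iff_of_isFrobPow (GaloisRep.toLocal q ρ) hI hφ m).2 hφm g

/-- **Every additive endomorphism of `M` commutes with the local twist at an `E`-split prime**: if
`Γ_{K_q}` acts trivially on `M`, then for every `φ : M →+ M`, `g ∈ Γ_{K_q}`, `x ∈ 𝒯_J`:
`g·(φ ∘ x) = φ ∘ (g·x)` — `φ ⊗ 1` is a `Γ_{K_q}`-endomorphism of `𝒯_J|_q` (the `α`/`β` of the tree's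
`cupProduct_adjoint`; KOLY-MEMO §5.11.B (N1)). [cite: MazurRubin2004, §1.3 and §5.3] -/
theorem toLocal_twistModP_comp_endo
    (htriv : ∀ (g : absoluteGaloisGroup (q.adicCompletion K)) (m : M), GaloisRep.toLocal q ρ g m = m)
    (φ : M →+ M) (g : absoluteGaloisGroup (q.adicCompletion K)) (x : Fin J → M) :
    GaloisRep.toLocal q (κ.twistModP ρ hM J) g (fun i => φ (x i)) =
      fun i => φ (GaloisRep.toLocal q (κ.twistModP ρ hM J) g x i) := by
  rw [toLocal_twistModP_apply, toLocal_twistModP_apply]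
  have h1 : (fun i => GaloisRep.toLocal q ρ g (φ (x i))) = fun i => φ (x i) := funext fun i => htriv g _
  have h2 : (fun i => GaloisRep.toLocal q ρ g (x i)) = x := funext fun i => htriv g _
  rw [h1, h2]
  have h := LinearMap.congr_fun (ZpExtension.unipotentPow_mul_compLeft (M := M) (J := J)
      (κ.twistExponent J (absGaloisRestrict K (q.adicCompletion K) g)) φ.toIntLinearMap) x
  simp only [Module.End.mul_apply] at h
  exact h

/-- The same at an `E`-split Frobenius (hypotheses of §1 combined). [cite: MazurRubin2004, §1.3 and §5.3] -/
theorem toLocal_twistModP_comp_endo_of_split (hunr : GaloisRep.IsUnramifiedAt q ρ)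
    {φF : absoluteGaloisGroup (q.adicCompletion K)} (hφF : IsFrobPow φF 1)
    (hsplit : ρ (absGaloisRestrict K (q.adicCompletion K) φF) = 1)
    (φ : M →+ M) (g : absoluteGaloisGroup (q.adicCompletion K)) (x : Fin J → M) :
    GaloisRep.toLocal q (κ.twistModP ρ hM J) g (fun i => φ (x i)) =
      fun i => φ (GaloisRep.toLocal q (κ.twistModP ρ hM J) g x i) :=
  toLocal_twistModP_comp_endo ρ hM κ J q (toLocal_apply_eq_self_of_split ρ q hunr hφF hsplit) φ g x

end Split

/-! ## §2 Adjoint pairs for the convolution / Gorenstein pairing -/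

section Adjoint

variable {M M' P : Type*} [AddCommGroup M] [AddCommGroup M'] [AddCommGroup P]
  (e : M →+ M' →+ P) {J : ℕ}

/-- **Adjoint pairs pass through every convolution coefficient**: if `e(φ m, m′) = e(m, φ′ m′)` then
`C_k(φ ∘ x, y) = C_k(x, φ′ ∘ y)` (termwise). The `hc` of the tree's `cupProduct_adjoint` for k6-ty's
`twistContPairing`, coefficientwise. [cite: MazurRubin2004, §1.3 and §5.3] -/
theorem convCoeff_comp_adjoint {φ : M →+ M} {φ' : M' →+ M'}
    (hadj : ∀ m m', e (φ m) m' = e m (φ' m')) (k : ℕ) (x : Fin J → M) (y : Fin J → M') :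
    convCoeff e J k (fun i => φ (x i)) y = convCoeff e J k x (fun i => φ' (y i)) := by
  rw [convCoeff_def, convCoeff_def]
  refine sum_congr rfl fun a _ => ?_
  rw [coeffFun_map, coeffFun_map, hadj]

/-- The same for the Gorenstein pairing `B = C_{J−1}`. [cite: MazurRubin2004, §1.3 and §5.3] -/
theorem gorensteinPairing_comp_adjoint {φ : M →+ M} {φ' : M' →+ M'}
    (hadj : ∀ m m', e (φ m) m' = e m (φ' m')) (x : Fin J → M) (y : Fin J → M') :
    gorensteinPairing e J (fun i => φ (x i)) y = gorensteinPairing e J x (fun i => φ' (y i)) := by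
  rw [gorensteinPairing_apply, gorensteinPairing_apply]
  exact convCoeff_comp_adjoint e hadj _ x y

/-- **The rank-one adjoint pairs of `e`** (those of `bilin_eq_mul_of_natural_rankOne`): for `v₂ ∈ M`,
`w₁ ∈ M′` the endomorphisms `φ = e(·, w₁)•v₂` of `M` and `φ′ = e(v₂, ·)•w₁` of `M′` are `e`-adjoint when
`e` is balanced for the scalars (`e(c•m, m′) = c•e(m,m′) = e(m, c•m′)`, automatic over `ℤ`).
[cite: MazurRubin2004, §1.3 and §5.3] -/
theorem rankOne_adjoint {R : Type*} [CommRing R] [Module R M] [Module R M']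
    (eR : M →ₗ[R] M' →ₗ[R] R) (v₂ : M) (w₁ : M') (m : M) (m' : M') :
    eR (eR m w₁ • v₂) m' = eR m (eR v₂ m' • w₁) := by
  rw [LinearMap.map_smul₂, LinearMap.map_smul, smul_eq_mul, smul_eq_mul, mul_comm]

end Adjoint

end Summit.BirchSwinnertonDyer.BirchSwinnertonDyer.Rank1Residual.LocalSplitPrime

end
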